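import Summits.AtomisticToContinuum.Crystallization.Theorems.ExcessDecayLiouvilleComparisonEnergy
import Summits.AtomisticToContinuum.Crystallization.Theorems.ExcessDecayLiouvilleFluxPairingSq

/-!
# Route `ExcessDecayLiouville`: the energy of the Dirichlet correction, decay-aware far field (nonlinear half, V′)

Harmonic-replacement architecture for item `ExcessDecay` (stmt-AtomisticToContinuum-9334), nonlinear half.
The variant of `nnForm_correction_le` (`ExcessDecayLiouvilleComparisonEnergy.lean`) in which the far pairs
of the flux pairing are estimated by `flux_pairing_le''` (square sums) instead of a crude sup bound, so that the
estimate keeps the decay of the field at small scales of the excess-decay iteration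
(`nnForm_correction_le'`): with `P = 400ρ'/189 + 2` (Poincaré),

`nnForm w ≤ 2(a² + b²)/κ²`, `a = (‖f‖_{ℓ²(FW)} + Λ(3F₈(L)√E_B(ṽ) + √F₈(L)√Θ₂)) P`, `b = 4·10⁶ Λ √NN[ṽ]`.

All `[folklore]`; helper lemmas, nothing here closes an item.
-/

noncomputable section

namespace Summit.AtomisticToContinuum.Crystallization.Theorems.ExcessDecayLiouville

open scoped BigOperators Topology InnerProductSpace RealInnerProductSpace Classical
open Literature.MathematicalPhysics.StatisticalMechanics
open Summit.AtomisticToContinuum.Crystallization.Theorems.PhononStabilityNegative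

-- Local notation: the force-constant map `K(e)w = h(|e|²)w + 2⟪e,w⟫h′(|e|²)e`.
local notation3 "𝕂[" e "] " w:max =>
  (-((‖e‖ ^ 2)⁻¹) ^ 7 + ((‖e‖ ^ 2)⁻¹) ^ 4) • w + (2 * ⟪e, w⟫ * (7 * ((‖e‖ ^ 2)⁻¹) ^ 8 - 4 * ((‖e‖ ^ 2)⁻¹) ^ 5)) • e

section

variable {t : Fin 2 → (EuclideanSpace ℝ (Fin 3))} {A : (EuclideanSpace ℝ (Fin 3)) →L[ℝ] (EuclideanSpace ℝ (Fin 3))}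
  {κ : ℝ}

variable (hA : Adm₀ A) (hI : Inner₀ t A)

set_option quotPrecheck false in
-- Local notation: the operator row `(L v)(p)`.
local notation "𝕃" v:max " @ " p:max =>
  tsum (fun q : Sites₀ t A => (if ((p : Sites₀ t A) : EuclideanSpace ℝ (Fin 3)) ≠ q then
    𝕂[((p : Sites₀ t A) : EuclideanSpace ℝ (Fin 3)) - q] (v ((p : Sites₀ t A) : EuclideanSpace ℝ (Fin 3)) - v q) else 0))
set_option quotPrecheck false in
-- Local notation: the finite near-neighbour form on the ball of radius `X` about `c`.
local notation "NN[" v ", " c ", " X "]" =>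
  (∑ p ∈ (finite_sites_dist_le (t := t) (A := A) hA hI c X).toFinset,
    ∑ q ∈ (finite_sites_dist_le (t := t) (A := A) hA hI c X).toFinset,
      (if p ≠ q ∧ dist p q ≤ 11 / 10 then ‖v p - v q‖ ^ 2 else (0 : ℝ)))

/-! ## The bound of the correction energy -/

/-- **Energy of the Dirichlet correction, decay-aware far field** (see the module docstring). [folklore] -/
theorem nnForm_correction_le' (hκ0 : 0 < κ)
    (hκ : ∀ v : (EuclideanSpace ℝ (Fin 3)) → (EuclideanSpace ℝ (Fin 3)), (Function.support v).Finite →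
      Function.support v ⊆ Sites₀ t A → κ * nnForm t A v ≤ ∑' p : Sites₀ t A, ⟪𝕃 v @ p, v p⟫)
    {w : (EuclideanSpace ℝ (Fin 3)) → (EuclideanSpace ℝ (Fin 3))} (hw : (Function.support w).Finite)
    (FW SR : Finset (EuclideanSpace ℝ (Fin 3))) (hFW : ∀ x, w x ≠ 0 → x ∈ FW) (hFWSR : FW ⊆ SR)
    (hSRS : ∀ x ∈ SR, x ∈ Sites₀ t A) (f : (EuclideanSpace ℝ (Fin 3)) → (EuclideanSpace ℝ (Fin 3)))
    (Φ : (EuclideanSpace ℝ (Fin 3)) → (EuclideanSpace ℝ (Fin 3)) → (EuclideanSpace ℝ (Fin 3)))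
    (hrow : ∀ p : Sites₀ t A, (p : EuclideanSpace ℝ (Fin 3)) ∈ FW →
      𝕃 w @ p = f p + ∑ q ∈ SR.erase p, Φ p q)
    (hanti : ∀ p ∈ SR, ∀ q ∈ SR, Φ q p = -Φ p q)
    {c₀ : EuclideanSpace ℝ (Fin 3)} {ρ' : ℝ} (hρ' : 1 ≤ ρ') (hFWball : ∀ x ∈ FW, dist x c₀ ≤ ρ')
    {vt : (EuclideanSpace ℝ (Fin 3)) → (EuclideanSpace ℝ (Fin 3))} {Λ Θ₂ L : ℝ} (hΛ : 0 ≤ Λ) (hL : 1 ≤ L)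
    (hΦ : ∀ p ∈ SR, ∀ q ∈ SR, p ≠ q → ‖Φ p q‖ ≤ Λ * (dist p q)⁻¹ ^ 8 * ‖vt p - vt q‖)
    (hΘ : ∑ p ∈ SR.filter (fun p => dist p c₀ ≤ ρ'),
      ∑ q ∈ (SR.erase p).filter (fun q => ¬ dist p q ≤ L), (dist p q)⁻¹ ^ 8 * ‖vt q‖ ^ 2 ≤ Θ₂) :
    nnForm t A w ≤ 2 * (((Real.sqrt (∑ x ∈ FW, ‖f x‖ ^ 2) +
        Λ * (3 * (1024 / ((23 / 25 : ℝ) ^ 3 * L ^ 5)) * Real.sqrt (∑ x ∈ SR.filter (fun p => dist p c₀ ≤ ρ'), ‖vt x‖ ^ 2) +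
          Real.sqrt (1024 / ((23 / 25 : ℝ) ^ 3 * L ^ 5)) * Real.sqrt Θ₂)) * (400 * ρ' / 189 + 2)) ^ 2 +
      (4000000 * Λ * Real.sqrt (NN[vt, c₀, ρ' + 10 * L + 20])) ^ 2) / κ ^ 2 := by
  classical
  have hE := comparison_energy_abs hκ hw FW SR hFW hFWSR hSRS f Φ hrow hanti
  have hwB : ∀ x, w x ≠ 0 → x ∈ SR ∧ dist x c₀ ≤ ρ' := fun x hx => ⟨hFWSR (hFW x hx), hFWball x (hFW x hx)⟩
  have hΨ := flux_pairing_le'' hA hI hw SR hSRS hwB Φ hanti hΛ hL hΦ hΘ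
  -- norms of w
  set N := nnForm t A w with hNdef
  have hN0 : 0 ≤ N := nnForm_nonneg t A w
  set P : ℝ := 400 * ρ' / 189 + 2 with hP
  have hP0 : 0 ≤ P := by rw [hP]; positivity
  have hwS : Function.support w ⊆ Sites₀ t A := fun x hx => hSRS x (hFWSR (hFW x hx))
  have hsupp : Function.support w ⊆ Metric.closedBall c₀ ρ' := fun x hx => by
    rw [Metric.mem_closedBall]; exact hFWball x (hFW x hx)
  have hPoinc := tsum_norm_sq_le_mul_nnForm hA hI hw (by linarith) hsupp
  -- Σ_{FW} ‖w‖² ≤ Σ' ‖w‖² ≤ P² N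
  have hFWmem : ∀ x ∈ FW, x ∈ Sites₀ t A := fun x hx => hSRS x (hFWSR hx)
  have hl2 : ∑ x ∈ FW, ‖w x‖ ^ 2 ≤ P ^ 2 * N := by
    refine le_trans ?_ hPoinc
    rw [← Finset.sum_subtype_of_mem (f := fun x => ‖w x‖ ^ 2) hFWmem]
    exact (summable_normSq_of_finite (t := t) (A := A) hw).sum_le_tsum _ fun _ _ => sq_nonneg _
  have hsqrt_l2 : Real.sqrt (∑ x ∈ FW, ‖w x‖ ^ 2) ≤ P * Real.sqrt N := by
    calc Real.sqrt (∑ x ∈ FW, ‖w x‖ ^ 2) ≤ Real.sqrt (P ^ 2 * N) := Real.sqrt_le_sqrt hl2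
      _ = P * Real.sqrt N := by rw [Real.sqrt_mul (sq_nonneg _), Real.sqrt_sq hP0]
  -- Σ_{FW} ‖f‖‖w‖ ≤ ‖f‖₂ ‖w‖₂
  have hfw : ∑ x ∈ FW, ‖f x‖ * ‖w x‖ ≤ Real.sqrt (∑ x ∈ FW, ‖f x‖ ^ 2) * Real.sqrt (∑ x ∈ FW, ‖w x‖ ^ 2) := by
    have h := Finset.sum_mul_sq_le_sq_mul_sq FW (fun x => ‖f x‖) (fun x => ‖w x‖)
    have h0 : 0 ≤ ∑ x ∈ FW, ‖f x‖ * ‖w x‖ := Finset.sum_nonneg fun _ _ => by positivity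
    rw [← Real.sqrt_mul (Finset.sum_nonneg fun _ _ => sq_nonneg _), ← Real.sqrt_sq h0]
    exact Real.sqrt_le_sqrt h
  -- √(Σ_{SR} ‖w‖²) = √(Σ_{FW} ‖w‖²) ≤ P √N
  have hSRFW : ∑ x ∈ SR, ‖w x‖ ^ 2 = ∑ x ∈ FW, ‖w x‖ ^ 2 := by
    symm
    refine Finset.sum_subset hFWSR fun x _ hx => ?_
    have : w x = 0 := by by_contra h; exact hx (hFW x h)
    rw [this, norm_zero]; ring
  have hsqrt_SR : Real.sqrt (∑ x ∈ SR, ‖w x‖ ^ 2) ≤ P * Real.sqrt N := by rw [hSRFW]; exact hsqrt_l2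
  -- assemble κ X² ≤ a X + b X
  set X := Real.sqrt N with hX
  have hX0 : 0 ≤ X := Real.sqrt_nonneg _
  have hXN : X ^ 2 = N := Real.sq_sqrt hN0
  set F8 : ℝ := 1024 / ((23 / 25 : ℝ) ^ 3 * L ^ 5) with hF8
  have hF80 : 0 ≤ F8 := by rw [hF8]; positivity
  generalize hG : 3 * F8 * Real.sqrt (∑ x ∈ SR.filter (fun p => dist p c₀ ≤ ρ'), ‖vt x‖ ^ 2) + Real.sqrt F8 * Real.sqrt Θ₂ = G at hΨ
  have hG0 : 0 ≤ G := by rw [← hG]; positivity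
  set a : ℝ := (Real.sqrt (∑ x ∈ FW, ‖f x‖ ^ 2) + Λ * G) * P with ha
  set b : ℝ := 4000000 * Λ * Real.sqrt (NN[vt, c₀, ρ' + 10 * L + 20]) with hb
  have ha0 : 0 ≤ a := by rw [ha]; positivity
  have hb0 : 0 ≤ b := by rw [hb]; positivity
  have hkey : κ * X ^ 2 ≤ a * X + b * X := by
    rw [hXN]
    have h1 : ∑ x ∈ FW, ‖f x‖ * ‖w x‖ ≤ Real.sqrt (∑ x ∈ FW, ‖f x‖ ^ 2) * (P * X) :=
      hfw.trans (mul_le_mul_of_nonneg_left hsqrt_l2 (Real.sqrt_nonneg _))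
    have h2 : (1 / 2) * ∑ p ∈ SR, ∑ q ∈ SR.erase p, ‖Φ p q‖ * ‖w p - w q‖ ≤
        Λ * (4000000 * Real.sqrt (NN[vt, c₀, ρ' + 10 * L + 20]) * X + G * (P * X)) := by
      have h3 : G * Real.sqrt (∑ x ∈ SR, ‖w x‖ ^ 2) ≤ G * (P * X) := mul_le_mul_of_nonneg_left hsqrt_SR hG0
      have h3' := mul_le_mul_of_nonneg_left h3 hΛ
      linarith [hΨ, h3']
    have h4 : κ * N ≤ Real.sqrt (∑ x ∈ FW, ‖f x‖ ^ 2) * (P * X) +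
        Λ * (4000000 * Real.sqrt (NN[vt, c₀, ρ' + 10 * L + 20]) * X + G * (P * X)) := by linarith
    have h5 : Real.sqrt (∑ x ∈ FW, ‖f x‖ ^ 2) * (P * X) +
        Λ * (4000000 * Real.sqrt (NN[vt, c₀, ρ' + 10 * L + 20]) * X + G * (P * X)) = a * X + b * X := by
      rw [ha, hb]; ring
    linarith
  have := (sqrt_energy_le hκ0 hX0 ha0 hb0 hkey).2
  rw [hXN] at this
  exact this

end

end Summit.AtomisticToContinuum.Crystallization.Theorems.ExcessDecayLiouville

end
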